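import Mathlib
import Summits.Ventures.HodgeRepro2.Tier7.Line3.Unfolding

/-!
# Tier7/Line3/GeometricSide — the double-coset structure of the geometric side (abstract)

Filer: t7-L1-p3 (gen 3, prover-pub-hodge-repro2-t7-L1-p3-g3-0), TARGET line STATUS l. 15112. Lane: SUPPORT for
Line 3's version-(ii) chain (L3-ARGUMENT.md §2: «GEOMETRIC SIDE `Σ_{γ ∈ T_A(F)\G(F)/T_B(F)} ∫ … f(t⁻¹ γ t′) μ_A(t)
conj μ_B(t′)` — for REGULAR `γ` (trivial stabiliser) the inner integral is the product of local double-torus orbital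
integrals»); NOT a line, NOT a device.

WHAT IT SUPPLIES (Mathlib only; the adelic tori are abstract groups `A`, `B` with left-invariant measures, their
rational points countable subgroups `ΓA`, `ΓB` with fundamental domains `sA`, `sB`, the ambient group `G` with
`ιA : A →* G`, `ιB : B →* G`; p1's rows 690/691 end at «Σ_{γ ∈ Γ} of the double periods of the terms»):

* `isFundamentalDomain_prod` (O1): `sA ×ˢ sB` is a fundamental domain for `ΓA.prod ΓB` acting on `A × B`
  by left multiplication, for the product measure;
* `integral_prod_eq_setIntegral_tsum` (O2): the unfolding over `A × B`,
  `∫ F ∂(μA.prod μB) = ∫_{sA ×ˢ sB} ∑_{(a,b) ∈ ΓA × ΓB} F (a t, b t′)` (from `Unfolding.integral_eq_setIntegral_tsum`);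
* `integral_orbital_eq_setIntegral_tsum_range` (O3): REGULAR DOUBLE-COSET TERM = ORBITAL INTEGRAL — if the orbit
  map `(a, b) ↦ ιA(a)⁻¹ γ ιB(b)` is injective on `ΓA × ΓB` (trivial stabiliser) and `χA`, `χB` are left-invariant
  weights, then `∫_{A × B} F(ιA(t)⁻¹ γ ιB(t′)) χA(t) χB(t′) = ∫_{sA ×ˢ sB} (∑_{g ∈ ΓA γ ΓB} F(ιA(t)⁻¹ g ιB(t′))) χA(t) χB(t′)`,
  given the integrability of the left-hand side: the double period of the `γ`-class of the Poincaré series is the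
  global orbital integral `O_γ(f)`;
* `tsum_eq_tsum_fiberwise` (O4): `∑_{g} P(g) = ∑_{classes c} ∑_{g ∈ c} P(g)` for a summable `P` and any class map;
  `tsum_eq_tsum_doubleCoset` (O4′): the same with the classes `H \ Γ / K` of Mathlib's `DoubleCoset.Quotient`;
* `range_orbitMap_eq_doubleCoset` (O5): the orbit of `γ` under `(a, b) ↦ ιA(a)⁻¹ γ ιB(b)` is Mathlib's double coset
  `DoubleCoset.doubleCoset γ (ΓA.map ιA) (ΓB.map ιB)`.

So: geometric side = (p1 row 691) `Σ_{γ ∈ Γ} ∬ F(t⁻¹ γ t′) χ` = (O4′) `Σ_{classes} Σ_{γ ∈ class} ∬ …` and, for a class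
with TRIVIAL stabiliser, (O3)+(O5) `= ∬_{A × B} F(t⁻¹ γ₀ t′) χ` — the global orbital integral, whose factorisation into
local orbital integrals (restricted products), the regularity of the classes (`κ ∉ {0, 1}`, p1 rows 662/663 at the
matrix level) and the singular classes stay in words with the dictionary.

CAVEAT (the common centre; L3-ARGUMENT.md §2 «Centre»). For the real pair `T_A, T_B ⊂ U(W_A)` both tori contain the
centre `Z = E′¹`, so the stabiliser of EVERY `γ` in `T_A(F) × T_B(F)` contains the diagonal `Z(F)^Δ` and the orbit map of
(O3) is never injective there; «regular» in §2 means «stabiliser = `Z(F)^Δ` exactly», the integrand is `Z(𝔸)^Δ`-invariant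
by the central match (C), and the class term is `vol(Z(F)\Z(𝔸)) · ∫_{Z(𝔸)^Δ \ (T_A(𝔸) × T_B(𝔸))} …`. (O3) is therefore
the stabiliser-free identity (exact for tori with trivial common stabiliser, e.g. after dividing both tori by the
centre); the version with a displayed stabiliser subgroup `S ≤ ΓA × ΓB` — class term `= ∫_{S \ (A × B)}` over a
fundamental domain of `S` — is the next row (`GeometricSideStab`, announced on the bus), not this file.
Nothing about `X`; nothing about the step (P) is claimed.

§8(d) (uses an L-value-free non-vanishing device): NO — double-coset bookkeeping.
-/

namespace Summit.Ventures.HodgeRepro2.Tier7.Line3.GeometricSide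

open MeasureTheory
open scoped ENNReal Pointwise

/-! ### (O4) fiberwise regrouping of a summable series -/

section Fiberwise

variable {ι C : Type*}

/-- (O4) A summable series regrouped along the fibres of any class map `q`:
`∑' i, P i = ∑' c, ∑' i : q ⁻¹' {c}, P i`. -/
theorem tsum_eq_tsum_fiberwise (P : ι → ℂ) (hP : Summable P) (q : ι → C) :
    ∑' i, P i = ∑' c, ∑' i : q ⁻¹' {c}, P i :=
  (hP.hasSum.tsum_fiberwise q).tsum_eq.symm

/-- (O4′) A summable series on a group `Γ` regrouped along the double cosets `H \ Γ / K`
(Mathlib's `DoubleCoset.Quotient` / `quotToDoubleCoset`). -/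
theorem tsum_eq_tsum_doubleCoset {Γ : Type*} [Group Γ] (H K : Subgroup Γ) (P : Γ → ℂ)
    (hP : Summable P) :
    ∑' g, P g = ∑' i : DoubleCoset.Quotient (H : Set Γ) K,
      ∑' g : DoubleCoset.quotToDoubleCoset H K i, P g := by
  rw [tsum_eq_tsum_fiberwise P hP (DoubleCoset.mk H K)]
  apply tsum_congr
  intro i
  apply tsum_congr_set_coe
  ext g
  rw [Set.mem_preimage, Set.mem_singleton_iff, DoubleCoset.mem_quotToDoubleCoset_iff]

end Fiberwise

/-! ### (O5) the orbit of `γ` is a double coset -/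

section Orbit

variable {A B G : Type*} [Group A] [Group B] [Group G]

/-- The orbit map `(a, b) ↦ ιA(a)⁻¹ * γ * ιB(b)` of the two tori on `γ`. -/
theorem range_orbitMap_eq_doubleCoset (ιA : A →* G) (ιB : B →* G) (ΓA : Subgroup A)
    (ΓB : Subgroup B) (γ : G) :
    Set.range (fun q : ΓA × ΓB => (ιA q.1)⁻¹ * γ * ιB q.2) =
      DoubleCoset.doubleCoset γ (ΓA.map ιA : Set G) (ΓB.map ιB) := by
  ext g
  rw [DoubleCoset.mem_doubleCoset]
  constructor
  · rintro ⟨q, rfl⟩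
    refine ⟨(ιA q.1)⁻¹, ?_, ιB q.2, ?_, rfl⟩
    · rw [← map_inv]
      exact Subgroup.mem_map_of_mem ιA (ΓA.inv_mem q.1.2)
    · exact Subgroup.mem_map_of_mem ιB q.2.2
  · rintro ⟨x, hx, y, hy, rfl⟩
    obtain ⟨a, ha, rfl⟩ := Subgroup.mem_map.mp hx
    obtain ⟨b, hb, rfl⟩ := Subgroup.mem_map.mp hy
    refine ⟨(⟨a⁻¹, ΓA.inv_mem ha⟩, ⟨b, hb⟩), ?_⟩
    simp only [map_inv, inv_inv]

end Orbit

/-! ### (O1)–(O3) the product unfolding and the regular double-coset term -/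

section Product

variable {A B : Type*} [Group A] [Group B] [MeasurableSpace A] [MeasurableSpace B]
  [MeasurableMul A] [MeasurableMul B] {μA : Measure A} {μB : Measure B}
  [μA.IsMulLeftInvariant] [μB.IsMulLeftInvariant] [SFinite μA] [SFinite μB]
  {ΓA : Subgroup A} {ΓB : Subgroup B} [Countable ΓA] [Countable ΓB] {sA : Set A} {sB : Set B}

omit [MeasurableSpace A] [MeasurableSpace B] [MeasurableMul A] [MeasurableMul B] in
/-- The product of two countable subgroups is countable (not an instance: a `have` in the proofs). -/
theorem countable_prod : Countable (ΓA.prod ΓB) :=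
  Countable.of_equiv (ΓA × ΓB) (Subgroup.prodEquiv ΓA ΓB).symm.toEquiv

/-- Left multiplication on `A × B` is measurable in each variable (not an instance: a `have` in the proofs). -/
theorem measurableMul_prod : MeasurableMul (A × B) where
  measurable_const_mul c :=
    (measurable_fst.const_mul c.1).prodMk (measurable_snd.const_mul c.2)
  measurable_mul_const c :=
    (measurable_fst.mul_const c.1).prodMk (measurable_snd.mul_const c.2)

omit [MeasurableSpace A] [MeasurableSpace B] [MeasurableMul A] [MeasurableMul B]
  [μA.IsMulLeftInvariant] [μB.IsMulLeftInvariant] [SFinite μA] [SFinite μB] [Countable ΓA]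
  [Countable ΓB] in
/-- The smul of `ΓA.prod ΓB` on `A × B` is componentwise left multiplication. -/
theorem prod_smul_eq (δ : ΓA.prod ΓB) (p : A × B) :
    δ • p = ((δ : A × B).1 * p.1, (δ : A × B).2 * p.2) := by
  rw [Subgroup.smul_def, smul_eq_mul]
  rfl

omit [MeasurableMul A] [MeasurableMul B] [μA.IsMulLeftInvariant] [μB.IsMulLeftInvariant]
  [SFinite μA] [Countable ΓA] [Countable ΓB] in
/-- (O1) **Product of fundamental domains.** If `sA`, `sB` are fundamental domains for the countable subgroups
`ΓA ≤ A`, `ΓB ≤ B` (left multiplication), then `sA ×ˢ sB` is a fundamental domain for `ΓA.prod ΓB` acting on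
`A × B`, for the product measure `μA.prod μB`. -/
theorem isFundamentalDomain_prod (hA : IsFundamentalDomain ΓA sA μA)
    (hB : IsFundamentalDomain ΓB sB μB) :
    IsFundamentalDomain (ΓA.prod ΓB) (sA ×ˢ sB) (μA.prod μB) where
  nullMeasurableSet := hA.nullMeasurableSet.prod hB.nullMeasurableSet
  ae_covers := by
    have h1 : ∀ᵐ p ∂(μA.prod μB), ∃ a : ΓA, a • p.1 ∈ sA := by
      rw [ae_iff]
      refine measure_mono_null (t := {t | ¬ ∃ a : ΓA, a • t ∈ sA} ×ˢ (Set.univ : Set B)) ?_ ?_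
      · intro p hp
        exact ⟨hp, Set.mem_univ _⟩
      · rw [Measure.prod_prod, ae_iff.mp hA.ae_covers, zero_mul]
    have h2 : ∀ᵐ p ∂(μA.prod μB), ∃ b : ΓB, b • p.2 ∈ sB := by
      rw [ae_iff]
      refine measure_mono_null (t := (Set.univ : Set A) ×ˢ {t | ¬ ∃ b : ΓB, b • t ∈ sB}) ?_ ?_
      · intro p hp
        exact ⟨Set.mem_univ _, hp⟩
      · rw [Measure.prod_prod, ae_iff.mp hB.ae_covers, mul_zero]
    filter_upwards [h1, h2] with p hp1 hp2
    obtain ⟨a, ha⟩ := hp1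
    obtain ⟨b, hb⟩ := hp2
    refine ⟨⟨((a : A), (b : B)), Subgroup.mem_prod.mpr ⟨a.2, b.2⟩⟩, ?_⟩
    rw [prod_smul_eq]
    exact Set.mk_mem_prod ha hb
  aedisjoint := by
    intro δ δ' hne
    show (μA.prod μB) (δ • (sA ×ˢ sB) ∩ δ' • (sA ×ˢ sB)) = 0
    -- the translate of the product is the product of the translates
    have hsub : ∀ ε : ΓA.prod ΓB, ε • (sA ×ˢ sB) ⊆
        ((ε : A × B).1 • sA) ×ˢ ((ε : A × B).2 • sB) := by
      rintro ε _ ⟨p, hp, rfl⟩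
      show ε • p ∈ _
      rw [prod_smul_eq]
      exact Set.mk_mem_prod (Set.smul_mem_smul_set hp.1) (Set.smul_mem_smul_set hp.2)
    have hcomp : (δ : A × B).1 ≠ (δ' : A × B).1 ∨ (δ : A × B).2 ≠ (δ' : A × B).2 := by
      by_contra h
      push Not at h
      exact hne (Subtype.ext (Prod.ext h.1 h.2))
    rcases hcomp with h | h
    · -- first components differ: the `A`-translates are a.e. disjoint
      have hdisj : μA (((δ : A × B).1 • sA) ∩ ((δ' : A × B).1 • sA)) = 0 := by
        have hne' : (⟨(δ : A × B).1, (Subgroup.mem_prod.mp δ.2).1⟩ : ΓA) ≠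
            ⟨(δ' : A × B).1, (Subgroup.mem_prod.mp δ'.2).1⟩ :=
          fun heq => h (congrArg Subtype.val heq)
        exact hA.aedisjoint hne'
      refine measure_mono_null (t := (((δ : A × B).1 • sA) ∩ ((δ' : A × B).1 • sA)) ×ˢ
        (Set.univ : Set B)) ?_ ?_
      · intro p hp
        exact ⟨⟨(hsub δ hp.1).1, (hsub δ' hp.2).1⟩, Set.mem_univ _⟩
      · rw [Measure.prod_prod, hdisj, zero_mul]
    · -- second components differ: the `B`-translates are a.e. disjoint
      have hdisj : μB (((δ : A × B).2 • sB) ∩ ((δ' : A × B).2 • sB)) = 0 := by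
        have hne' : (⟨(δ : A × B).2, (Subgroup.mem_prod.mp δ.2).2⟩ : ΓB) ≠
            ⟨(δ' : A × B).2, (Subgroup.mem_prod.mp δ'.2).2⟩ :=
          fun heq => h (congrArg Subtype.val heq)
        exact hB.aedisjoint hne'
      refine measure_mono_null (t := (Set.univ : Set A) ×ˢ
        (((δ : A × B).2 • sB) ∩ ((δ' : A × B).2 • sB))) ?_ ?_
      · intro p hp
        exact ⟨Set.mem_univ _, ⟨(hsub δ hp.1).2, (hsub δ' hp.2).2⟩⟩
      · rw [Measure.prod_prod, hdisj, mul_zero]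

/-- (O2) **The product unfolding.** For fundamental domains `sA`, `sB` and an integrable `F : A × B → ℂ`,
`∫ F ∂(μA.prod μB) = ∫_{sA ×ˢ sB} ∑_{(a, b) ∈ ΓA × ΓB} F (a * t, b * t′)`. -/
theorem integral_prod_eq_setIntegral_tsum (hA : IsFundamentalDomain ΓA sA μA)
    (hB : IsFundamentalDomain ΓB sB μB) (F : A × B → ℂ) (hF : Integrable F (μA.prod μB)) :
    ∫ p, F p ∂(μA.prod μB) =
      ∫ p in sA ×ˢ sB, ∑' q : ΓA × ΓB, F ((q.1 : A) * p.1, (q.2 : B) * p.2) ∂(μA.prod μB) := by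
  haveI : Countable (ΓA.prod ΓB) := countable_prod
  haveI : MeasurableMul (A × B) := measurableMul_prod
  rw [Unfolding.integral_eq_setIntegral_tsum (isFundamentalDomain_prod hA hB) F hF]
  congr 1
  funext p
  rw [← (Subgroup.prodEquiv ΓA ΓB).symm.toEquiv.tsum_eq (fun δ : ΓA.prod ΓB => F (δ • p))]
  apply tsum_congr
  intro q
  rw [prod_smul_eq]
  rfl

/-- (O3) **Double-coset term with trivial stabiliser = orbital integral.** Let `ιA : A →* G`, `ιB : B →* G`, `γ ∈ G`
with the orbit map `(a, b) ↦ ιA(a)⁻¹ * γ * ιB(b)` injective on `ΓA × ΓB` (trivial stabiliser — see the CAVEAT in the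
module docstring: for tori with a common centre this is the form modulo the centre), `F : G → ℂ`,
and `χA`, `χB` left-invariant under `ΓA`, `ΓB`. If `(t, t′) ↦ F(ιA(t)⁻¹ γ ιB(t′)) χA(t) χB(t′)` is integrable on
`A × B`, then its integral equals the double period over `sA ×ˢ sB` of the `γ`-class of the Poincaré series:
`∫_{A × B} F(ιA(t)⁻¹ γ ιB(t′)) χA(t) χB(t′) = ∫_{sA ×ˢ sB} (∑_{g ∈ ΓA γ ΓB} F(ιA(t)⁻¹ g ιB(t′))) χA(t) χB(t′)`. -/
theorem integral_orbital_eq_setIntegral_tsum_range {G : Type*} [Group G]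
    (hA : IsFundamentalDomain ΓA sA μA) (hB : IsFundamentalDomain ΓB sB μB)
    (ιA : A →* G) (ιB : B →* G) (γ : G) (F : G → ℂ) (χA : A → ℂ) (χB : B → ℂ)
    (hχA : ∀ a : ΓA, ∀ t, χA ((a : A) * t) = χA t) (hχB : ∀ b : ΓB, ∀ t, χB ((b : B) * t) = χB t)
    (hreg : Function.Injective (fun q : ΓA × ΓB => (ιA q.1)⁻¹ * γ * ιB q.2))
    (hint : Integrable (fun p : A × B => F ((ιA p.1)⁻¹ * γ * ιB p.2) * (χA p.1 * χB p.2))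
      (μA.prod μB)) :
    ∫ p, F ((ιA p.1)⁻¹ * γ * ιB p.2) * (χA p.1 * χB p.2) ∂(μA.prod μB) =
      ∫ p in sA ×ˢ sB,
        (∑' g : Set.range (fun q : ΓA × ΓB => (ιA q.1)⁻¹ * γ * ιB q.2),
          F ((ιA p.1)⁻¹ * (g : G) * ιB p.2)) * (χA p.1 * χB p.2) ∂(μA.prod μB) := by
  rw [integral_prod_eq_setIntegral_tsum hA hB _ hint]
  congr 1
  funext p
  -- each term of the unfolded sum is the term of the orbit element
  have hterm : ∀ q : ΓA × ΓB,
      F ((ιA ((q.1 : A) * p.1))⁻¹ * γ * ιB ((q.2 : B) * p.2)) *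
          (χA ((q.1 : A) * p.1) * χB ((q.2 : B) * p.2)) =
        F ((ιA p.1)⁻¹ * ((ιA q.1)⁻¹ * γ * ιB q.2) * ιB p.2) * (χA p.1 * χB p.2) := by
    intro q
    rw [hχA, hχB, map_mul, map_mul, mul_inv_rev]
    simp only [mul_assoc]
  rw [tsum_congr hterm, tsum_mul_right]
  congr 1
  -- reindex the orbit by the injective orbit map
  rw [← (Equiv.ofInjective _ hreg).tsum_eq
    (fun g : Set.range (fun q : ΓA × ΓB => (ιA q.1)⁻¹ * γ * ιB q.2) =>
      F ((ιA p.1)⁻¹ * (g : G) * ιB p.2))]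
  rfl

end Product

end Summit.Ventures.HodgeRepro2.Tier7.Line3.GeometricSide
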